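import Summits.ABC.IUTFork.Thm311LinkGlue
import Summits.ABC.IUTFork.Thm311PartIIIDischarge
import Summits.ABC.IUTFork.Thm311PartIILattice
import Summits.ABC.IUTFork.Thm311RealTate
import HarnessLib

/-!
# [IUTchIII] Theorem 3.11 AS TYPED, assembled at the REAL instantiation: what the premise of record amounts to

Proof-only file (D-0012; no new definitions) of the abc-iut cell (Cor. 3.12 sub-crew, seat abc-iut-c312-1 — the
typer of [IUTchIII] Thm. 3.11 —, gen 4); TAKES NO SIDE on [IUTchIII] Cor. 3.12. The cell's PREMISE OF RECORD for
the Cor. 3.12 adjudication is this seat's `Summit.ABC.IUTFork.Thm311.FullSituation.Statement` (file D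
`Thm311LinkCompat`: Theorem 3.11 (i) ∧ (ii) ∧ (iii) as the author states it, kurims May-2020 manuscript
`paper:url-4b091feeb646` pp. 153–159, typed over named signatures). Since it was typed, the bottom-up layers
have supplied REAL instances of every signature it quantifies over:

* (i)/(ii)-data: abc-iut-c312-5's `LatticeSituation.ofShells` over the real coric log-shells `Real.logShells X logv …`
  of a pilot datum `X : PilotData F` (`Thm311Real`, `Thm311Real2`, `Thm311Real3`: local fields `K_v`, log-shells
  `I_v`, tensor packets, Arakelov divisors `FinDivisor F` for (c)'s global realified Frobenioids with
  `deg := FinDivisor.deg F`, lgp-divisors for `C^⊩_LGP`, the Θ-pilot object := Dupuy–Hilado's `P_Θ`), the data (b)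
  at the bad places := c312-5's exact LGP splitting monoid `Real.splittingMonoidLGP` (`Thm311RealTate` §3, the
  image of abc-iut-L6-t2's Gaussian monoid `μ_{2l}·ξ^ℕ`), each column's Frobenius-like data read STRICTLY (:= the
  coric data of its line, c312-5's "strictified reading"), the (Ind3) unit-group images := the pure tensors of
  abc-iut-w4-d029's honest log-link iterate images `Real.iterImage logv m'` and the radius-`π` balls := pure
  tensors of the shells (abc-iut-w4-d087, `Thm311PartIILattice`);
* (iii)-objects: this seat's `LinkData.ofGlueRadial G Λ FM` (file L `Thm311LinkGlue`) — the objects of (iii)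
  CONSTRUCTED over ANY log-theta lattice `Λ` glued from abc-iut-L6-t3's [IUTchIII] §1–§2 interfaces
  (`LatticeGlue`, bi-coric `F^{⊢×μ}_△`, Kummer natural isomorphism of Thm. 1.5 (iii), Prop. 2.1 (vi), Cor. 2.3's
  radial data `Radial.coreFunctor`), the `∞κ` functor `FM` of [IUTchII] Cor. 4.7 (iii) an argument.

This file ASSEMBLES the two halves into one `FullSituation (Real.thetaIndex X)` (written inline; no definition is
introduced) and records, with fully-qualified closing types, WHAT THE TYPED THEOREM 3.11 AMOUNTS TO THERE:

* `Real.full_statement_iff_degreeClause` — **it is EQUIVALENT to its own clause (i) (c)** (`Situation.DegreeClause`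
  = [IUTchIII] Thm. 3.11 (i) (c) "whose associated "global degrees" may be computed by means of the log-volumes of
  (a) [cf. Proposition 3.9, (iii)]"): (i) (b)'s placement clause is c312-5's `psiInSubPackets_ofShells_of_LGP`,
  (i)'s concluding multiradial compatibility `^{n,∘}R^{LGP} = ^{n',∘}R^{LGP}` holds by `rfl` for line data that do
  not depend on `n` (c312-5's `multiradialCompat_of_const` — the bi-coric strictification), (ii) is w4-d087's
  `partII_ofShells_honestImages` (given the law `O_v ⊆ I_v` on the logarithm binder and `L.shellPk ⊆ archPk` at
  archimedean `v_ℚ`; NO hypothesis at the analytic logarithms with `archPk := L.shellPk`: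
  `full_statement_iff_degreeClause_defined`), (iii) is this seat's `partIII_ofGlueRadial` / L
  `statement_iff_of_glue` ((a)(b) tautologies of the signature, (c)(d) functoriality);
* `Real.degreeClause_iff` — that residual clause UNFOLDED at the real instance: for every line `n`, label
  `j ∈ F_l^⋇` and Arakelov divisor `J`, the regions `region n j J v_ℚ` are admissible, finitely many have non-zero
  log-volume, and `FinDivisor.deg F J = ∑ᶠ_{v_ℚ} logvol (region n j J v_ℚ)` — i.e. exactly [IUTchIII] Prop. 3.9
  (iii) p. 117 ("the global log-volume […] is equal to the degree of the arithmetic line bundle determined by `J`") for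
  the log-volume and region BINDERS (their real discharge — Haar log-volumes of abc-iut-S2, regions of ideals —
  is Team B's row B-4 / Team A's A-3 «degreesAsLogVolumes» in plan/C312-TEAMS.md; not done here);
* `Real.not_full_statement_of_logvol_zero` — NON-TAUTOLOGY at the real carriers: with the log-volume binder
  `logvol := 0` the typed Theorem 3.11 FAILS there (c312-3's `PilotData.deg_qPilot_pos`: `deg P_q > 0`), so the
  premise of record is a genuine constraint on (`logvol`, `region`) and on nothing else;
* `Real.full_statement_iff` — the general census form for line data that MAY depend on `n` (binders
  `Ψ act Mmod : ℤ → …`): `Statement ↔ (∀ n, PsiInSubPackets) ∧ DegreeClause ∧ MultiradialCompat`.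

HONEST FRAMING. These are measurements of the TYPING (cell rule "vacuity-audit every fork-level hypothesis";
ADJUDICATION-SPEC §3 (b) "if Thm 3.11's own typed parts are meanwhile DISCHARGED for the real setting, say so"),
not an opinion on the mathematics: in the author's text the content of Theorem 3.11 is carried by the
CONSTRUCTIONS it names (the multiradial representation, the log-Kummer correspondence), which the bi-coric
strictification of files A–D renders as identifications — cf. LANA Rem. 8.2.1, Scholze–Stix 2018 §2.2, and this
seat's `Thm311ToCor312Checks.independence` (typed Thm. 3.11 + side conditions do not imply typed Cor. 3.12). The
universe pin `S : StripFrame.{0}` is the tree's current one (F-w5d029-1: the kit-assembled frame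
`StripFrame.ofKits` lives in `max 1 u`; the owner-accepted R-a patch generalises these slots, after which the
theorems below specialise to the real frame as well). Sources read on the page (this seat's render of `paper:url-4b091feeb646`): p. 154 l. 46–47 (Thm.
3.11 (i) (c)), p. 117 l. 40–42 (Prop. 3.9 (iii)). [claim: Mochizuki2012, status: disputed] [cite: LANA2026Report, Rem. 8.2.1 p. 42]
Deliberately NOT here: any definition; any change to files A–P or to c312-5's / w4-d087's files; the discharge of
the degree clause; any judgement. typed ≠ proved; instantiated ≠ endorsed.
-/

namespace Summit.ABC.IUTFork.Thm311

open CategoryTheory Literature.IUT.LogThetaLattice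

/-! ## 1. Generic: Theorem 3.11 as typed with L6-glued (iii)-objects, for any (i)/(ii)-data -/

namespace FullSituation

variable {T : ThetaIndex}

/-- **Theorem 3.11 as typed, for ANY (i)/(ii)-data `S₀` and the (iii)-objects `LinkData.ofGlueRadial G Λ FM`**
(objects of (iii) constructed over an L6 log-theta lattice glued from [IUTchIII] §1–§2 data, radial data from
Cor. 2.3), is `(i) ∧ (ii)` — L's `statement_iff_of_glue` at `FR := Radial.coreFunctor G.coric`. BOOKKEEPING,
neutral. [claim: Mochizuki2012, status: disputed] -/
theorem statement_ofGlueRadial_iff (S₀ : LatticeSituation T) {F : StripFrame.{0}} (G : LatticeGlue F)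
    (Λ : LogThetaLatticeDiagram G.logData G.linkData) {Kap : Type} [Category.{0} Kap] (FM : Core F.DHT ⥤ Kap) :
    Summit.ABC.IUTFork.Thm311.FullSituation.Statement
        ({ S₀ with link := LinkData.ofGlueRadial G Λ FM } : FullSituation T) ↔ S₀.PartI ∧ S₀.PartII :=
  statement_iff_of_glue S₀ G Λ (Radial.coreFunctor G.coric) FM

/-- The same with (i) split into its three typed clauses: (i) (b)'s placement `PsiInSubPackets` at every line,
(i) (c)'s `DegreeClause`, and (i)'s concluding `MultiradialCompat`. [claim: Mochizuki2012, status: disputed] -/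
theorem statement_ofGlueRadial_iff_clauses (S₀ : LatticeSituation T) {F : StripFrame.{0}} (G : LatticeGlue F)
    (Λ : LogThetaLatticeDiagram G.logData G.linkData) {Kap : Type} [Category.{0} Kap] (FM : Core F.DHT ⥤ Kap) :
    Summit.ABC.IUTFork.Thm311.FullSituation.Statement
        ({ S₀ with link := LinkData.ofGlueRadial G Λ FM } : FullSituation T) ↔
      ((∀ n : ℤ, (S₀.D n).PsiInSubPackets) ∧ S₀.DegreeClause ∧ S₀.MultiradialCompat) ∧ S₀.PartII :=
  statement_ofGlueRadial_iff S₀ G Λ FM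

end FullSituation

/-! ## 2. The real instantiation -/

namespace Real

open NumberField IsDedekindDomain Literature.IUT.LogVolume

variable {F : Type} [Field F] [NumberField F]
variable (X : PilotData F) (logv : PadicLogs F) (Aut Ism : ∀ x : Place F, Set (Carrier x ≃ₗ[ℚ] Carrier x))
  (hAut : ∀ x, LinearEquiv.refl ℚ (Carrier x) ∈ Aut x) (hIsm : ∀ x, LinearEquiv.refl ℚ (Carrier x) ∈ Ism x)
  (archPk : ∀ (j : (thetaIndex X).Label) (vQ : (thetaIndex X).VQ),
    Set ((logShells X logv Aut Ism hAut hIsm).Packet j vQ))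
  (archSub : ∀ (j : (thetaIndex X).Label) (v : Place F),
    Set ((logShells X logv Aut Ism hAut hIsm).Packet j ((thetaIndex X).over v)))
  (Adm : ∀ (j : (thetaIndex X).Label) (vQ : (thetaIndex X).VQ),
    Set ((logShells X logv Aut Ism hAut hIsm).Packet j vQ) → Prop)
  (logvol : ∀ (j : (thetaIndex X).Label) (vQ : (thetaIndex X).VQ),
    Set ((logShells X logv Aut Ism hAut hIsm).Packet j vQ) → ℝ)
  (Ψ : ℤ → ∀ v : Place F, v ∈ (thetaIndex X).Vbad → Set ((logShells X logv Aut Ism hAut hIsm).StarPacket v))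
  (act : ℤ → ∀ v : Place F, v ∈ (thetaIndex X).Vbad → (logShells X logv Aut Ism hAut hIsm).StarPacket v →
    Module.End ℚ ((logShells X logv Aut Ism hAut hIsm).StarPacket v))
  (Mmod : ℤ → ∀ j : (thetaIndex X).LabelStar, Set ((logShells X logv Aut Ism hAut hIsm).GlobalPacket j.1))
  (Ψ₀ : ∀ v : Place F, v ∈ (thetaIndex X).Vbad → Set ((logShells X logv Aut Ism hAut hIsm).StarPacket v))
  (act₀ : ∀ v : Place F, v ∈ (thetaIndex X).Vbad → (logShells X logv Aut Ism hAut hIsm).StarPacket v →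
    Module.End ℚ ((logShells X logv Aut Ism hAut hIsm).StarPacket v))
  (Mmod₀ : ∀ j : (thetaIndex X).LabelStar, Set ((logShells X logv Aut Ism hAut hIsm).GlobalPacket j.1))
  (region : ℤ → ∀ j : (thetaIndex X).LabelStar,
    FinDivisor F → ∀ vQ : (thetaIndex X).VQ, Set ((logShells X logv Aut Ism hAut hIsm).Packet j.1 vQ))
  (thetaDiv₀ : ℤ → ℤ → LgpDivisor F (thetaIndex X).lstar)
  {S : StripFrame.{0}} (G : LatticeGlue S) (Λ : LogThetaLatticeDiagram G.logData G.linkData)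
  {Kap : Type} [Category.{0} Kap] (FM : Core S.DHT ⥤ Kap)

/-! ### 2a. Line data that may depend on `n`: the census form -/

/-- **What the typed Theorem 3.11 amounts to at the real instantiation (general line data).** For the full
situation «c312-5's real lattice situation in the strictified reading with the honest (Ind3)-images ⊕ the
(iii)-objects glued from L6's §1–§2 data», given the law `O_v ⊆ I_v` on the logarithm binder and `L.shellPk ⊆ archPk`
at archimedean `v_ℚ` (w4-d087's hypotheses for (ii)): `Statement ↔ (∀ n, PsiInSubPackets) ∧ DegreeClause ∧
MultiradialCompat` — (ii) and (iii) are discharged, (i)'s three clauses remain. [claim: Mochizuki2012, status: disputed] -/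
theorem full_statement_iff (hlaw : LogvLaw logv)
    (harch : ∀ (j : (thetaIndex X).Label) (vQ : (thetaIndex X).VQ), ¬ (thetaIndex X).IsNon vQ →
      ((logShells X logv Aut Ism hAut hIsm).shellPk j vQ :
        Set ((logShells X logv Aut Ism hAut hIsm).Packet j vQ)) ⊆ archPk j vQ) :
    Summit.ABC.IUTFork.Thm311.FullSituation.Statement
      ({ LatticeSituation.ofShells (logShells X logv Aut Ism hAut hIsm) F archPk archSub Adm logvol Ψ act Mmod
            region (fun _ _ => Adm) (fun _ _ => logvol) (fun n _ => Ψ n) (fun n _ => Mmod n)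
            (fun _ _ m' j vQ =>
              (logShells X logv Aut Ism hAut hIsm).tprodImages j vQ fun v => iterImage logv m' v.1)
            (fun _ _ j vQ => (logShells X logv Aut Ism hAut hIsm).tprodImages j vQ fun v => shell logv v.1)
            thetaDiv₀ with
          link := LinkData.ofGlueRadial G Λ FM } : FullSituation (thetaIndex X)) ↔
      (∀ n : ℤ, (MRData.ofShells (logShells X logv Aut Ism hAut hIsm) archPk archSub Adm logvol (Ψ n) (act n)
          (Mmod n)).PsiInSubPackets) ∧
      (Situation.ofShells (logShells X logv Aut Ism hAut hIsm) F archPk archSub Adm logvol Ψ act Mmod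
          region).DegreeClause ∧
      (Situation.ofShells (logShells X logv Aut Ism hAut hIsm) F archPk archSub Adm logvol Ψ act Mmod
          region).MultiradialCompat := by
  rw [FullSituation.statement_ofGlueRadial_iff_clauses]
  exact and_iff_left (partII_ofShells_honestImages X logv Aut Ism hAut hIsm archPk archSub Adm logvol Ψ act Mmod
    region thetaDiv₀ hlaw harch)

/-! ### 2b. Coric line data (the bi-coric strictification): everything but the degree clause is discharged -/

/-- (i) (b)'s placement clause and (i)'s multiradial compatibility for CORIC line data whose (b)-slot at the bad
places is c312-5's LGP splitting monoid: both hold (c312-5's `psiInSubPackets_ofShells_of_LGP`,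
`multiradialCompat_of_const`). [claim: Mochizuki2012, status: disputed] -/
theorem psiInSubPackets_and_multiradialCompat_of_LGP
    (qroot : ∀ v : HeightOneSpectrum (𝓞 F), Carrier (.inr v : Place F))
    (ζ : ∀ v : HeightOneSpectrum (𝓞 F), (thetaIndex X).LabelStar → (Carrier (.inr v : Place F))ˣ)
    (hΨ : ∀ (v : HeightOneSpectrum (𝓞 F)) (hv : (.inr v : Place F) ∈ (thetaIndex X).Vbad),
      Ψ₀ (.inr v) hv = splittingMonoidLGP X logv Aut Ism hAut hIsm v (qroot v) (ζ v)) :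
    (∀ n : ℤ, (MRData.ofShells (logShells X logv Aut Ism hAut hIsm) archPk archSub Adm logvol ((fun _ => Ψ₀) n)
        ((fun _ => act₀) n) ((fun _ => Mmod₀) n)).PsiInSubPackets) ∧
      (Situation.ofShells (logShells X logv Aut Ism hAut hIsm) F archPk archSub Adm logvol (fun _ => Ψ₀)
        (fun _ => act₀) (fun _ => Mmod₀) region).MultiradialCompat :=
  ⟨fun _ => psiInSubPackets_ofShells_of_LGP X logv Aut Ism hAut hIsm archPk archSub Adm logvol Ψ₀ act₀ Mmod₀
      qroot ζ hΨ,
    Situation.multiradialCompat_of_const (logShells X logv Aut Ism hAut hIsm) F archPk archSub Adm logvol region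
      Ψ₀ act₀ Mmod₀⟩

/-- **THE TYPED THEOREM 3.11 AT THE REAL INSTANTIATION IS EQUIVALENT TO ITS DEGREE CLAUSE (i) (c).** Full
situation: c312-5's real lattice situation over `Real.logShells X logv …` with CORIC line data — (b) := the LGP
splitting monoid `Real.splittingMonoidLGP` at every bad place (any `2l`-th roots `qroot`, torsion profiles `ζ`),
its action `act₀`, the number fields `Mmod₀` —, strictified columns with the honest (Ind3)-images, the Θ-pilot
lgp-divisors `thetaDiv₀`, and the (iii)-objects `LinkData.ofGlueRadial G Λ FM` over any L6 glue; hypotheses: the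
law `O_v ⊆ I_v` on the logarithm binder and `L.shellPk ⊆ archPk` at archimedean `v_ℚ`. Then
`FullSituation.Statement ↔ Situation.DegreeClause`. What is discharged, by whom: (i) (b) placement — c312-5;
(i) multiradial compatibility — `rfl` (coric data); (ii) — w4-d087/w4-d029; (iii) — c312-1 (files J, L, P).
Measurement of the typing; no side taken. [claim: Mochizuki2012, status: disputed] -/
theorem full_statement_iff_degreeClause (hlaw : LogvLaw logv)
    (harch : ∀ (j : (thetaIndex X).Label) (vQ : (thetaIndex X).VQ), ¬ (thetaIndex X).IsNon vQ →
      ((logShells X logv Aut Ism hAut hIsm).shellPk j vQ :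
        Set ((logShells X logv Aut Ism hAut hIsm).Packet j vQ)) ⊆ archPk j vQ)
    (qroot : ∀ v : HeightOneSpectrum (𝓞 F), Carrier (.inr v : Place F))
    (ζ : ∀ v : HeightOneSpectrum (𝓞 F), (thetaIndex X).LabelStar → (Carrier (.inr v : Place F))ˣ)
    (hΨ : ∀ (v : HeightOneSpectrum (𝓞 F)) (hv : (.inr v : Place F) ∈ (thetaIndex X).Vbad),
      Ψ₀ (.inr v) hv = splittingMonoidLGP X logv Aut Ism hAut hIsm v (qroot v) (ζ v)) :
    Summit.ABC.IUTFork.Thm311.FullSituation.Statement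
      ({ LatticeSituation.ofShells (logShells X logv Aut Ism hAut hIsm) F archPk archSub Adm logvol (fun _ => Ψ₀)
            (fun _ => act₀) (fun _ => Mmod₀) region (fun _ _ => Adm) (fun _ _ => logvol) (fun _ _ => Ψ₀)
            (fun _ _ => Mmod₀)
            (fun _ _ m' j vQ =>
              (logShells X logv Aut Ism hAut hIsm).tprodImages j vQ fun v => iterImage logv m' v.1)
            (fun _ _ j vQ => (logShells X logv Aut Ism hAut hIsm).tprodImages j vQ fun v => shell logv v.1)
            thetaDiv₀ with
          link := LinkData.ofGlueRadial G Λ FM } : FullSituation (thetaIndex X)) ↔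
      (Situation.ofShells (logShells X logv Aut Ism hAut hIsm) F archPk archSub Adm logvol (fun _ => Ψ₀)
          (fun _ => act₀) (fun _ => Mmod₀) region).DegreeClause := by
  rw [full_statement_iff X logv Aut Ism hAut hIsm archPk archSub Adm logvol (fun _ => Ψ₀) (fun _ => act₀)
    (fun _ => Mmod₀) region thetaDiv₀ G Λ FM hlaw harch]
  obtain ⟨hψ, hmc⟩ := psiInSubPackets_and_multiradialCompat_of_LGP X logv Aut Ism hAut hIsm archPk archSub Adm
    logvol Ψ₀ act₀ Mmod₀ region qroot ζ hΨ
  exact ⟨fun h => h.2.1, fun h => ⟨hψ, h, hmc⟩⟩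

/-- **Theorem 3.11 as typed HOLDS at the real instantiation, given its degree clause** (and w4-d087's two
hypotheses for (ii)). [claim: Mochizuki2012, status: disputed] -/
theorem full_statement_of_degreeClause (hlaw : LogvLaw logv)
    (harch : ∀ (j : (thetaIndex X).Label) (vQ : (thetaIndex X).VQ), ¬ (thetaIndex X).IsNon vQ →
      ((logShells X logv Aut Ism hAut hIsm).shellPk j vQ :
        Set ((logShells X logv Aut Ism hAut hIsm).Packet j vQ)) ⊆ archPk j vQ)
    (qroot : ∀ v : HeightOneSpectrum (𝓞 F), Carrier (.inr v : Place F))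
    (ζ : ∀ v : HeightOneSpectrum (𝓞 F), (thetaIndex X).LabelStar → (Carrier (.inr v : Place F))ˣ)
    (hΨ : ∀ (v : HeightOneSpectrum (𝓞 F)) (hv : (.inr v : Place F) ∈ (thetaIndex X).Vbad),
      Ψ₀ (.inr v) hv = splittingMonoidLGP X logv Aut Ism hAut hIsm v (qroot v) (ζ v))
    (hdeg : (Situation.ofShells (logShells X logv Aut Ism hAut hIsm) F archPk archSub Adm logvol (fun _ => Ψ₀)
      (fun _ => act₀) (fun _ => Mmod₀) region).DegreeClause) :
    Summit.ABC.IUTFork.Thm311.FullSituation.Statement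
      ({ LatticeSituation.ofShells (logShells X logv Aut Ism hAut hIsm) F archPk archSub Adm logvol (fun _ => Ψ₀)
            (fun _ => act₀) (fun _ => Mmod₀) region (fun _ _ => Adm) (fun _ _ => logvol) (fun _ _ => Ψ₀)
            (fun _ _ => Mmod₀)
            (fun _ _ m' j vQ =>
              (logShells X logv Aut Ism hAut hIsm).tprodImages j vQ fun v => iterImage logv m' v.1)
            (fun _ _ j vQ => (logShells X logv Aut Ism hAut hIsm).tprodImages j vQ fun v => shell logv v.1)
            thetaDiv₀ with
          link := LinkData.ofGlueRadial G Λ FM } : FullSituation (thetaIndex X)) :=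
  (full_statement_iff_degreeClause X logv Aut Ism hAut hIsm archPk archSub Adm logvol Ψ₀ act₀ Mmod₀ region
    thetaDiv₀ G Λ FM hlaw harch qroot ζ hΨ).2 hdeg

/-! ### 2c. The residual clause unfolded: [IUTchIII] Prop. 3.9 (iii) for the log-volume and region binders -/

/-- **The residual (i) (c) UNFOLDED at the real instance**: the degree clause of c312-5's real situation says
exactly that for every line `n`, every label `j ∈ F_l^⋇` and every Arakelov divisor `J : FinDivisor F`, the regions
`region n j J v_ℚ` are admissible, only finitely many have non-zero log-volume, and the Arakelov degree
`FinDivisor.deg F J` is the sum of their log-volumes — [IUTchIII] Prop. 3.9 (iii) p. 117 l. 40–42 for the BINDERS `Adm`,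
`logvol`, `region` (c312-5's `degreeClause_ofShells_iff`, `GlobalDegrees.ofDivisors`). [claim: Mochizuki2012, status: disputed] -/
theorem degreeClause_iff :
    (Situation.ofShells (logShells X logv Aut Ism hAut hIsm) F archPk archSub Adm logvol Ψ act Mmod
        region).DegreeClause ↔
      ∀ (n : ℤ) (j : (thetaIndex X).LabelStar) (J : FinDivisor F),
        (∀ vQ, Adm j.1 vQ (region n j J vQ)) ∧ {vQ | logvol j.1 vQ (region n j J vQ) ≠ 0}.Finite ∧
          FinDivisor.deg F J = ∑ᶠ vQ, logvol j.1 vQ (region n j J vQ) :=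
  Iff.rfl

/-- **NON-TAUTOLOGY at the real carriers.** With the log-volume binder `logvol := 0` the degree clause FAILS
(c312-3's `PilotData.deg_qPilot_pos`: the `q`-pilot divisor `P_q` has positive degree, while every sum of zero
log-volumes vanishes) — whatever the other binders. [cite: DupuyHilado2025, §3.3] -/
theorem not_degreeClause_of_logvol_zero :
    ¬ (Situation.ofShells (logShells X logv Aut Ism hAut hIsm) F archPk archSub Adm (fun _ _ _ => 0) Ψ act Mmod
        region).DegreeClause := by
  intro h
  have h1 := ((degreeClause_iff X logv Aut Ism hAut hIsm archPk archSub Adm (fun _ _ _ => 0) Ψ act Mmod region).1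
    h 0 ⟨Fin.last _, fun h0 => by
      have := congrArg Fin.val h0
      simp only [Fin.val_last, Fin.val_zero] at this
      have h2 := (thetaIndex X).two_le_lstar
      omega⟩ X.qPilot).2.2
  simp only [finsum_zero] at h1
  exact (ne_of_gt X.deg_qPilot_pos) h1

/-- **Hence the typed Theorem 3.11 FAILS at that real instantiation** (coric LGP line data, honest (Ind3)-images,
L6-glued (iii)-objects, `logvol := 0`): the premise of record is a genuine constraint on the log-volume / region
binders — and, by `full_statement_iff_degreeClause`, on nothing else. [claim: Mochizuki2012, status: disputed] -/
theorem not_full_statement_of_logvol_zero (hlaw : LogvLaw logv)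
    (harch : ∀ (j : (thetaIndex X).Label) (vQ : (thetaIndex X).VQ), ¬ (thetaIndex X).IsNon vQ →
      ((logShells X logv Aut Ism hAut hIsm).shellPk j vQ :
        Set ((logShells X logv Aut Ism hAut hIsm).Packet j vQ)) ⊆ archPk j vQ)
    (qroot : ∀ v : HeightOneSpectrum (𝓞 F), Carrier (.inr v : Place F))
    (ζ : ∀ v : HeightOneSpectrum (𝓞 F), (thetaIndex X).LabelStar → (Carrier (.inr v : Place F))ˣ)
    (hΨ : ∀ (v : HeightOneSpectrum (𝓞 F)) (hv : (.inr v : Place F) ∈ (thetaIndex X).Vbad),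
      Ψ₀ (.inr v) hv = splittingMonoidLGP X logv Aut Ism hAut hIsm v (qroot v) (ζ v)) :
    ¬ Summit.ABC.IUTFork.Thm311.FullSituation.Statement
      ({ LatticeSituation.ofShells (logShells X logv Aut Ism hAut hIsm) F archPk archSub Adm (fun _ _ _ => 0)
            (fun _ => Ψ₀) (fun _ => act₀) (fun _ => Mmod₀) region (fun _ _ => Adm) (fun _ _ _ _ _ => 0)
            (fun _ _ => Ψ₀) (fun _ _ => Mmod₀)
            (fun _ _ m' j vQ =>
              (logShells X logv Aut Ism hAut hIsm).tprodImages j vQ fun v => iterImage logv m' v.1)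
            (fun _ _ j vQ => (logShells X logv Aut Ism hAut hIsm).tprodImages j vQ fun v => shell logv v.1)
            thetaDiv₀ with
          link := LinkData.ofGlueRadial G Λ FM } : FullSituation (thetaIndex X)) := fun h =>
  not_degreeClause_of_logvol_zero X logv Aut Ism hAut hIsm archPk archSub Adm (fun _ => Ψ₀) (fun _ => act₀)
    (fun _ => Mmod₀) region
    ((full_statement_iff_degreeClause X logv Aut Ism hAut hIsm archPk archSub Adm (fun _ _ _ => 0) Ψ₀ act₀ Mmod₀
      region thetaDiv₀ G Λ FM hlaw harch qroot ζ hΨ).1 h)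

end Real

end Summit.ABC.IUTFork.Thm311
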